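import Summits.QuantumFields.YangMills.Theorems.LuscherReductionTwistedTraceScalingBOCentralEventually
import Summits.QuantumFields.YangMills.Theorems.LuscherReductionTwistedTraceScalingBOCentralModelBounds
import HarnessLib

/-!
# (B-O) central tube — rates of the factors of the two-sided bound of record (schedule B)

Companion of `…BOCentralRecord` / `…BOCentralRates` (`ε = β^{-1}`, `T = 45L·β^{-1/2}ℓ² + β^{-1}`, `ρ = 8T`, `r = β^{-1}ℓ³`,
`r_f = min(1/40, β^{-1/2}ℓ)`, `R_in = r_f/12`): §1 atoms `β·r·r_f, β·ρ²·r_f, β·ρ⁴ → 0`; §2 the factors tending to `1`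
(curvature, `e^{c|P|ρ³β}`, `e^{c|E|βρ⁴}`, `1 ± C_pδ²`, `e^{±882βT²R_in²}`); §3 ★ the slice Laplace tail `→ 0` even against the
Gaussian loss `e^{49β|E|ρ²} = e^{O(ℓ⁴)}`; §4 ★ the relative Gaussian tail of the lower bound `→ 0`.
-/

open MeasureTheory Filter Topology Real
open scoped BigOperators
open Literature.MathematicalPhysics.QuantumFieldTheory
open Literature.MathematicalPhysics.QuantumLattice

namespace Summit.QuantumFields.YangMills.Theorems.FemtoTransferGap.TwoLattice.ConstTube

open Summit.QuantumFields.YangMills.Theorems.FemtoTransferGap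
open Summit.QuantumFields.YangMills.Theorems.FemtoTransferGap.TwoLattice
open Summit.QuantumFields.YangMills.Theorems.FemtoTransferGap.TwoLattice.Stiff

variable {L : ℕ}

/-! ## §1 Helpers and atoms -/

/-- `f → 0 ⇒ e^{f} → 1`. [folklore] -/
theorem tendsto_exp_one_of_tendsto_zero {f : ℝ → ℝ} (hf : Tendsto f atTop (𝓝 0)) : Tendsto (fun β => Real.exp (f β)) atTop (𝓝 1) := by
  have h := (Real.continuous_exp.tendsto 0).comp hf
  rwa [Real.exp_zero] at h

/-- `f → 0 ⇒ e^{-f} → 1`. [folklore] -/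
theorem tendsto_exp_neg_one_of_tendsto_zero {f : ℝ → ℝ} (hf : Tendsto f atTop (𝓝 0)) : Tendsto (fun β => Real.exp (-f β)) atTop (𝓝 1) := by
  have h0 : Tendsto (fun β => -f β) atTop (𝓝 0) := by simpa using hf.neg
  exact tendsto_exp_one_of_tendsto_zero h0

/-- `T ≥ β^{-1/2}ℓ ≥ r_f` for `β ≥ 1` (the central tube is wider than the profile radius). [folklore] -/
theorem rf_le_schedT [NeZero L] (β : ℝ) :
    min (1 / 40) (powScale (1 / 2) β * btLog β) ≤ 9 * (L : ℝ) * (5 * (powScale (1 / 2) β * btLog β ^ 2)) + powScale 1 β := by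
  have hL1 : (1 : ℝ) ≤ L := by exact_mod_cast NeZero.one_le
  have hℓ := one_le_btLog β
  have hx := (powScale_pos (1 / 2) β).le
  have he := (powScale_pos 1 β).le
  have h1 : powScale (1 / 2) β * btLog β ≤ powScale (1 / 2) β * btLog β ^ 2 := by
    rw [sq, ← mul_assoc]
    exact le_mul_of_one_le_right (by positivity) hℓ
  have h2 : powScale (1 / 2) β * btLog β ^ 2 ≤ 9 * (L : ℝ) * (5 * (powScale (1 / 2) β * btLog β ^ 2)) := by
    have h0 : 0 ≤ powScale (1 / 2) β * btLog β ^ 2 := by positivity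
    nlinarith
  exact (min_le_right _ _).trans (by linarith)

/-- Atom `β·r·r_f ≤ β^{-1/2}ℓ⁴ → 0`. [folklore] -/
theorem tendsto_beta_core_rf :
    Tendsto (fun β : ℝ => β * (powScale 1 β * btLog β ^ 3) * min (1 / 40) (powScale (1 / 2) β * btLog β)) atTop (𝓝 0) := by
  have hup : Tendsto (fun β : ℝ => powScale (1 / 2) β * btLog β ^ 4) atTop (𝓝 0) := tendsto_powScale_mul_btLog_pow (by norm_num) 4
  refine tendsto_of_tendsto_of_tendsto_of_le_of_le' tendsto_const_nhds hup ?_ ?_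
  · filter_upwards [eventually_ge_atTop (1 : ℝ)] with β hβ
    have := powScale_pos 1 β; have := powScale_pos (1 / 2) β; have := one_le_btLog β
    have : 0 ≤ min (1 / 40) (powScale (1 / 2) β * btLog β) := le_min (by norm_num) (by positivity)
    positivity
  · filter_upwards [eventually_ge_atTop (1 : ℝ)] with β hβ
    have hx := (powScale_pos (1 / 2) β).le; have hℓ := one_le_btLog β
    have h1 : β * powScale 1 β = 1 := mul_powScale_one hβ
    calc β * (powScale 1 β * btLog β ^ 3) * min (1 / 40) (powScale (1 / 2) β * btLog β)
        ≤ β * (powScale 1 β * btLog β ^ 3) * (powScale (1 / 2) β * btLog β) := by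
          have := powScale_pos 1 β
          exact mul_le_mul_of_nonneg_left (min_le_right _ _) (by positivity)
      _ = (β * powScale 1 β) * (powScale (1 / 2) β * btLog β ^ 4) := by ring
      _ = _ := by rw [h1, one_mul]

/-- Atom `β·ρ²·r_f → 0` (`≤ 64(45L+1)²·β^{-1/2}ℓ⁵`). [folklore] -/
theorem tendsto_beta_rho_sq_rf :
    Tendsto (fun β : ℝ => β * (8 * (9 * (L : ℝ) * (5 * (powScale (1 / 2) β * btLog β ^ 2)) + powScale 1 β)) ^ 2 *
      min (1 / 40) (powScale (1 / 2) β * btLog β)) atTop (𝓝 0) := by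
  have hup : Tendsto (fun β : ℝ => 64 * (45 * (L : ℝ) + 1) ^ 2 * (powScale (1 / 2) β * btLog β ^ 5)) atTop (𝓝 0) := by
    simpa using (tendsto_powScale_mul_btLog_pow (show (0 : ℝ) < 1 / 2 by norm_num) 5).const_mul (64 * (45 * (L : ℝ) + 1) ^ 2)
  refine tendsto_of_tendsto_of_tendsto_of_le_of_le' tendsto_const_nhds hup ?_ ?_
  · filter_upwards [eventually_ge_atTop (1 : ℝ)] with β hβ
    have := powScale_pos 1 β; have := powScale_pos (1 / 2) β; have := one_le_btLog β
    have : 0 ≤ min (1 / 40) (powScale (1 / 2) β * btLog β) := le_min (by norm_num) (by positivity)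
    positivity
  · filter_upwards [eventually_ge_atTop (1 : ℝ)] with β hβ
    have hx := (powScale_pos (1 / 2) β).le; have hℓ := one_le_btLog β
    have hT0 : 0 ≤ 9 * (L : ℝ) * (5 * (powScale (1 / 2) β * btLog β ^ 2)) + powScale 1 β := by
      have := powScale_pos 1 β; positivity
    have hT := schedT_le (L := L) hβ
    have h2 : β * powScale (1 / 2) β ^ 2 = 1 := mul_powScale_half_sq hβ
    have hβ0 : 0 ≤ β := by linarith
    have hmin0 : 0 ≤ min (1 / 40) (powScale (1 / 2) β * btLog β) := le_min (by norm_num) (by positivity)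
    calc β * (8 * (9 * (L : ℝ) * (5 * (powScale (1 / 2) β * btLog β ^ 2)) + powScale 1 β)) ^ 2 * min (1 / 40) (powScale (1 / 2) β * btLog β)
        ≤ β * (8 * ((45 * (L : ℝ) + 1) * (powScale (1 / 2) β * btLog β ^ 2))) ^ 2 * (powScale (1 / 2) β * btLog β) := by
          gcongr
          exact min_le_right _ _
      _ = 64 * (45 * (L : ℝ) + 1) ^ 2 * (powScale (1 / 2) β * btLog β ^ 5) * (β * powScale (1 / 2) β ^ 2) := by ring
      _ = _ := by rw [h2, mul_one]

/-- Atom `β·ρ⁴ → 0`. [folklore] -/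
theorem tendsto_beta_rho_four :
    Tendsto (fun β : ℝ => β * (8 * (9 * (L : ℝ) * (5 * (powScale (1 / 2) β * btLog β ^ 2)) + powScale 1 β)) ^ 4) atTop (𝓝 0) := by
  have h := (tendsto_beta_rho_cube (L := L)).mul (tendsto_schedRho (L := L))
  rw [zero_mul] at h
  refine h.congr' (Eventually.of_forall fun β => ?_)
  simp only; ring

/-! ## §2 The factors tending to `1` -/

/-- `(((1+ρ²)⁻¹)²)^{n} → 1`. [folklore] -/
theorem tendsto_curv_pow (n : ℕ) :
    Tendsto (fun β : ℝ => (((1 + (8 * (9 * (L : ℝ) * (5 * (powScale (1 / 2) β * btLog β ^ 2)) + powScale 1 β)) ^ 2)⁻¹) ^ 2) ^ n) atTop (𝓝 1) := by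
  have hρ := tendsto_schedRho (L := L)
  have h1 : Tendsto (fun β : ℝ => 1 + (8 * (9 * (L : ℝ) * (5 * (powScale (1 / 2) β * btLog β ^ 2)) + powScale 1 β)) ^ 2) atTop (𝓝 1) := by
    simpa using tendsto_const_nhds.add (hρ.pow 2)
  simpa using ((h1.inv₀ one_ne_zero).pow 2).pow n

/-- `e^{c·ρ³β} → 1` for every real `c`. [folklore] -/
theorem tendsto_exp_rho_cube (c : ℝ) :
    Tendsto (fun β : ℝ => Real.exp (c * (8 * (9 * (L : ℝ) * (5 * (powScale (1 / 2) β * btLog β ^ 2)) + powScale 1 β)) ^ 3 * β)) atTop (𝓝 1) := by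
  have h := (tendsto_beta_rho_cube (L := L)).const_mul c
  rw [mul_zero] at h
  refine (tendsto_exp_one_of_tendsto_zero h).congr' (Eventually.of_forall fun β => ?_)
  simp only; ring_nf

/-- `e^{-(c·ρ³β)} → 1` for every real `c`. [folklore] -/
theorem tendsto_exp_neg_rho_cube (c : ℝ) :
    Tendsto (fun β : ℝ => Real.exp (-(c * (8 * (9 * (L : ℝ) * (5 * (powScale (1 / 2) β * btLog β ^ 2)) + powScale 1 β)) ^ 3 * β))) atTop (𝓝 1) := by
  have h := tendsto_exp_rho_cube (L := L) (-c)
  refine h.congr' (Eventually.of_forall fun β => ?_)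
  simp only [neg_mul]

/-- `e^{c·β·ρ⁴} → 1` for every real `c`. [folklore] -/
theorem tendsto_exp_beta_rho_four (c : ℝ) :
    Tendsto (fun β : ℝ => Real.exp (c * β * (8 * (9 * (L : ℝ) * (5 * (powScale (1 / 2) β * btLog β ^ 2)) + powScale 1 β)) ^ 4)) atTop (𝓝 1) := by
  have h := (tendsto_beta_rho_four (L := L)).const_mul c
  rw [mul_zero] at h
  refine (tendsto_exp_one_of_tendsto_zero h).congr' (Eventually.of_forall fun β => ?_)
  simp only; ring_nf

/-- `1 + C·(1·δ)² → 1` for `δ = β^{-1/4}` and every real `C`. [folklore] -/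
theorem tendsto_one_add_defect (C : ℝ) : Tendsto (fun β : ℝ => 1 + C * (1 * powScale (1 / 4) β) ^ 2) atTop (𝓝 1) := by
  have h := ((tendsto_powScale (show (0 : ℝ) < 1 / 4 by norm_num)).pow 2).const_mul C
  simpa using tendsto_const_nhds.add h

/-- `1 - C·(1·δ)² → 1` for `δ = β^{-1/4}` and every real `C`. [folklore] -/
theorem tendsto_one_sub_defect (C : ℝ) : Tendsto (fun β : ℝ => 1 - C * (1 * powScale (1 / 4) β) ^ 2) atTop (𝓝 1) := by
  have h := ((tendsto_powScale (show (0 : ℝ) < 1 / 4 by norm_num)).pow 2).const_mul C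
  simpa using tendsto_const_nhds.sub h

/-- The localisation exponent `882βT²R_in² → 0` (`R_in = r_f/12`). [folklore] -/
theorem tendsto_loc_exponent :
    Tendsto (fun β : ℝ => 882 * β * (9 * (L : ℝ) * (5 * (powScale (1 / 2) β * btLog β ^ 2)) + powScale 1 β) ^ 2 *
      (min (1 / 40) (powScale (1 / 2) β * btLog β) / 12) ^ 2) atTop (𝓝 0) := by
  have hup : Tendsto (fun β : ℝ => 882 / 144 * (β * (9 * (L : ℝ) * (5 * (powScale (1 / 2) β * btLog β ^ 2)) + powScale 1 β) ^ 2 *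
      (powScale (1 / 2) β * btLog β) ^ 2)) atTop (𝓝 0) := by
    simpa using (tendsto_beta_T_sq_rf_sq (L := L)).const_mul (882 / 144)
  refine tendsto_of_tendsto_of_tendsto_of_le_of_le' tendsto_const_nhds hup ?_ ?_
  · filter_upwards [eventually_ge_atTop (1 : ℝ)] with β hβ
    have hβ0 : 0 ≤ β := by linarith
    positivity
  · filter_upwards [eventually_ge_atTop (1 : ℝ)] with β hβ
    have hβ0 : 0 ≤ β := by linarith
    have hx := (powScale_pos (1 / 2) β).le; have hℓ := one_le_btLog β
    have hmin0 : 0 ≤ min (1 / 40) (powScale (1 / 2) β * btLog β) := le_min (by norm_num) (by positivity)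
    have hm : min (1 / 40) (powScale (1 / 2) β * btLog β) ^ 2 ≤ (powScale (1 / 2) β * btLog β) ^ 2 :=
      pow_le_pow_left₀ hmin0 (min_le_right _ _) 2
    calc 882 * β * (9 * (L : ℝ) * (5 * (powScale (1 / 2) β * btLog β ^ 2)) + powScale 1 β) ^ 2 * (min (1 / 40) (powScale (1 / 2) β * btLog β) / 12) ^ 2
        = 882 / 144 * (β * (9 * (L : ℝ) * (5 * (powScale (1 / 2) β * btLog β ^ 2)) + powScale 1 β) ^ 2 * min (1 / 40) (powScale (1 / 2) β * btLog β) ^ 2) := by ring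
      _ ≤ 882 / 144 * (β * (9 * (L : ℝ) * (5 * (powScale (1 / 2) β * btLog β ^ 2)) + powScale 1 β) ^ 2 * (powScale (1 / 2) β * btLog β) ^ 2) := by
          gcongr

/-- `e^{882βT²R_in²} → 1`. [folklore] -/
theorem tendsto_exp_loc :
    Tendsto (fun β : ℝ => Real.exp (882 * β * (9 * (L : ℝ) * (5 * (powScale (1 / 2) β * btLog β ^ 2)) + powScale 1 β) ^ 2 *
      (min (1 / 40) (powScale (1 / 2) β * btLog β) / 12) ^ 2)) atTop (𝓝 1) :=
  tendsto_exp_one_of_tendsto_zero tendsto_loc_exponent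

/-- `e^{-882βT²R_in²} → 1`. [folklore] -/
theorem tendsto_exp_neg_loc :
    Tendsto (fun β : ℝ => Real.exp (-(882 * β * (9 * (L : ℝ) * (5 * (powScale (1 / 2) β * btLog β ^ 2)) + powScale 1 β) ^ 2 *
      (min (1 / 40) (powScale (1 / 2) β * btLog β) / 12) ^ 2))) atTop (𝓝 1) :=
  tendsto_exp_neg_one_of_tendsto_zero tendsto_loc_exponent

/-! ## §3 ★ The slice Laplace tail against the Gaussian loss -/

/-- Pointwise: `(β^{-1}ℓ³)²/(4(β^{-1})²) = ℓ⁶/4`. [folklore] -/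
theorem core_sq_div_eps_sq (β : ℝ) : (powScale 1 β * btLog β ^ 3) ^ 2 / (4 * powScale 1 β ^ 2) = btLog β ^ 6 / 4 := by
  have hε := powScale_pos 1 β
  field_simp

/-- Pointwise: the Gaussian loss exponent `49β·|E|ρ² ≤ 49|E|·64(45L+1)²·ℓ⁴` for `β ≥ 1`. [folklore] -/
theorem gaussLoss_exponent_le [NeZero L] {β : ℝ} (hβ : 1 ≤ β) :
    (96 * (β / 2) + β) * (Real.sqrt ((Fintype.card (Edge 3 L) : ℝ)) * (8 * (9 * (L : ℝ) * (5 * (powScale (1 / 2) β * btLog β ^ 2)) + powScale 1 β))) ^ 2 ≤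
      49 * (Fintype.card (Edge 3 L) : ℝ) * (64 * (45 * (L : ℝ) + 1) ^ 2) * btLog β ^ 4 := by
  have hE : Real.sqrt ((Fintype.card (Edge 3 L) : ℝ)) ^ 2 = (Fintype.card (Edge 3 L) : ℝ) := Real.sq_sqrt (Nat.cast_nonneg _)
  have hE0 : (0 : ℝ) ≤ Fintype.card (Edge 3 L) := Nat.cast_nonneg _
  have hT := schedT_le (L := L) hβ
  have hT0 : 0 ≤ 9 * (L : ℝ) * (5 * (powScale (1 / 2) β * btLog β ^ 2)) + powScale 1 β := by
    have := powScale_pos 1 β; have := powScale_pos (1 / 2) β; positivity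
  have h2 : β * powScale (1 / 2) β ^ 2 = 1 := mul_powScale_half_sq hβ
  have hβ0 : 0 ≤ β := by linarith
  have hT2 : (9 * (L : ℝ) * (5 * (powScale (1 / 2) β * btLog β ^ 2)) + powScale 1 β) ^ 2 ≤ ((45 * (L : ℝ) + 1) * (powScale (1 / 2) β * btLog β ^ 2)) ^ 2 :=
    pow_le_pow_left₀ hT0 hT 2
  calc (96 * (β / 2) + β) * (Real.sqrt ((Fintype.card (Edge 3 L) : ℝ)) * (8 * (9 * (L : ℝ) * (5 * (powScale (1 / 2) β * btLog β ^ 2)) + powScale 1 β))) ^ 2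
      = 49 * (Real.sqrt ((Fintype.card (Edge 3 L) : ℝ)) ^ 2) * 64 * (β * (9 * (L : ℝ) * (5 * (powScale (1 / 2) β * btLog β ^ 2)) + powScale 1 β) ^ 2) := by ring
    _ ≤ 49 * (Fintype.card (Edge 3 L) : ℝ) * 64 * (β * ((45 * (L : ℝ) + 1) * (powScale (1 / 2) β * btLog β ^ 2)) ^ 2) := by rw [hE]; gcongr
    _ = 49 * (Fintype.card (Edge 3 L) : ℝ) * (64 * (45 * (L : ℝ) + 1) ^ 2) * btLog β ^ 4 * (β * powScale (1 / 2) β ^ 2) := by ring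
    _ = _ := by rw [h2, mul_one]

/-- ★ **The slice Laplace tail is negligible even against the Gaussian loss**:
`(1 + K_D((4+48K_sp)ρ)²)·4^{d/2}·e^{-c_L²ℓ⁶/4}·e^{49β|E|ρ²} → 0` (`c_L = 1/(4C_L)`, `e^{49β|E|ρ²} = e^{O_L(ℓ⁴)}`). [folklore] -/
theorem tendsto_sliceTail_mul_gaussLoss [NeZero L] (KD Ksp : ℝ) :
    Tendsto (fun β : ℝ => (1 + KD * ((4 + 48 * Ksp) * (8 * (9 * (L : ℝ) * (5 * (powScale (1 / 2) β * btLog β ^ 2)) + powScale 1 β))) ^ 2) *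
        (4 : ℝ) ^ (flatDim L / 2 : ℝ) * Real.exp (-((1 / (4 * sliceConst L)) ^ 2 * (powScale 1 β * btLog β ^ 3) ^ 2 / (4 * (powScale 1 β) ^ 2))) *
      Real.exp ((96 * (β / 2) + β) * (Real.sqrt ((Fintype.card (Edge 3 L) : ℝ)) * (8 * (9 * (L : ℝ) * (5 * (powScale (1 / 2) β * btLog β ^ 2)) + powScale 1 β))) ^ 2))
      atTop (𝓝 0) := by
  set c : ℝ := 1 / (4 * sliceConst L) with hcdef
  set M : ℝ := 49 * (Fintype.card (Edge 3 L) : ℝ) * (64 * (45 * (L : ℝ) + 1) ^ 2) with hMdef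
  have hc : 0 < c := by rw [hcdef]; have := sliceConst_pos L; positivity
  have hρ' : Tendsto (fun β : ℝ => KD * ((4 + 48 * Ksp) * (8 * (9 * (L : ℝ) * (5 * (powScale (1 / 2) β * btLog β ^ 2)) + powScale 1 β))) ^ 2) atTop (𝓝 0) := by
    simpa using (((tendsto_schedRho (L := L)).const_mul (4 + 48 * Ksp)).pow 2).const_mul KD
  have hρa : Tendsto (fun β : ℝ => |KD| * ((4 + 48 * Ksp) * (8 * (9 * (L : ℝ) * (5 * (powScale (1 / 2) β * btLog β ^ 2)) + powScale 1 β))) ^ 2) atTop (𝓝 0) := by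
    simpa using (((tendsto_schedRho (L := L)).const_mul (4 + 48 * Ksp)).pow 2).const_mul |KD|
  -- the dominating function
  have hup : Tendsto (fun β : ℝ => (1 + |KD| * ((4 + 48 * Ksp) * (8 * (9 * (L : ℝ) * (5 * (powScale (1 / 2) β * btLog β ^ 2)) + powScale 1 β))) ^ 2) *
      (4 : ℝ) ^ (flatDim L / 2 : ℝ) * Real.exp (-btLog β)) atTop (𝓝 0) := by
    have he : Tendsto (fun β : ℝ => Real.exp (-btLog β)) atTop (𝓝 0) :=
      Real.tendsto_exp_atBot.comp (tendsto_neg_atTop_atBot.comp tendsto_btLog_atTop)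
    simpa using ((tendsto_const_nhds.add hρa).mul (tendsto_const_nhds (x := (4 : ℝ) ^ (flatDim L / 2 : ℝ)))).mul he
  have hℓ2 : ∀ᶠ β : ℝ in atTop, 4 * (M + 1) / c ^ 2 ≤ btLog β ^ 2 :=
    ((tendsto_pow_atTop two_ne_zero).comp tendsto_btLog_atTop).eventually_ge_atTop _
  have hlow : ∀ᶠ β : ℝ in atTop, -(1 / 2 : ℝ) ≤ KD * ((4 + 48 * Ksp) * (8 * (9 * (L : ℝ) * (5 * (powScale (1 / 2) β * btLog β ^ 2)) + powScale 1 β))) ^ 2 :=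
    hρ'.eventually (Ici_mem_nhds (by norm_num))
  refine tendsto_of_tendsto_of_tendsto_of_le_of_le' tendsto_const_nhds hup ?_ ?_
  · filter_upwards [hlow] with β hlo
    have : 0 ≤ 1 + KD * ((4 + 48 * Ksp) * (8 * (9 * (L : ℝ) * (5 * (powScale (1 / 2) β * btLog β ^ 2)) + powScale 1 β))) ^ 2 := by linarith
    positivity
  · filter_upwards [hlow, hℓ2, eventually_ge_atTop (1 : ℝ)] with β hlo hl2 hβ
    have hℓ := one_le_btLog β
    have hP0 : 0 ≤ 1 + KD * ((4 + 48 * Ksp) * (8 * (9 * (L : ℝ) * (5 * (powScale (1 / 2) β * btLog β ^ 2)) + powScale 1 β))) ^ 2 := by linarith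
    have hP : 1 + KD * ((4 + 48 * Ksp) * (8 * (9 * (L : ℝ) * (5 * (powScale (1 / 2) β * btLog β ^ 2)) + powScale 1 β))) ^ 2 ≤
        1 + |KD| * ((4 + 48 * Ksp) * (8 * (9 * (L : ℝ) * (5 * (powScale (1 / 2) β * btLog β ^ 2)) + powScale 1 β))) ^ 2 := by
      gcongr; exact le_abs_self KD
    -- the exponent
    have hexp : -(c ^ 2 * (powScale 1 β * btLog β ^ 3) ^ 2 / (4 * powScale 1 β ^ 2)) +
        (96 * (β / 2) + β) * (Real.sqrt ((Fintype.card (Edge 3 L) : ℝ)) * (8 * (9 * (L : ℝ) * (5 * (powScale (1 / 2) β * btLog β ^ 2)) + powScale 1 β))) ^ 2 ≤ -btLog β := by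
      have h1 : c ^ 2 * (powScale 1 β * btLog β ^ 3) ^ 2 / (4 * powScale 1 β ^ 2) = c ^ 2 * (btLog β ^ 6 / 4) := by
        rw [mul_div_assoc, core_sq_div_eps_sq]
      have h2 := gaussLoss_exponent_le (L := L) hβ
      rw [← hMdef] at h2
      rw [h1]
      -- `c²ℓ⁶/4 - Mℓ⁴ ≥ ℓ⁴ ≥ ℓ` from `c²ℓ² ≥ 4(M+1)`
      have h3 : 4 * (M + 1) ≤ c ^ 2 * btLog β ^ 2 := by
        have := (div_le_iff₀ (by positivity : (0 : ℝ) < c ^ 2)).1 hl2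
        linarith
      have hℓ4 : btLog β ≤ btLog β ^ 4 := by
        calc btLog β = btLog β ^ 1 := (pow_one _).symm
          _ ≤ btLog β ^ 4 := pow_le_pow_right₀ hℓ (by norm_num)
      have hM0 : 0 ≤ M := by rw [hMdef]; positivity
      have hl40 : 0 ≤ btLog β ^ 4 := by positivity
      have key : btLog β ^ 4 ≤ c ^ 2 * (btLog β ^ 6 / 4) - M * btLog β ^ 4 := by
        have e : c ^ 2 * (btLog β ^ 6 / 4) - M * btLog β ^ 4 = btLog β ^ 4 * ((c ^ 2 * btLog β ^ 2) / 4 - M) := by ring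
        rw [e]
        have : 1 ≤ (c ^ 2 * btLog β ^ 2) / 4 - M := by linarith
        nlinarith
      linarith
    calc (1 + KD * ((4 + 48 * Ksp) * (8 * (9 * (L : ℝ) * (5 * (powScale (1 / 2) β * btLog β ^ 2)) + powScale 1 β))) ^ 2) *
          (4 : ℝ) ^ (flatDim L / 2 : ℝ) * Real.exp (-(c ^ 2 * (powScale 1 β * btLog β ^ 3) ^ 2 / (4 * powScale 1 β ^ 2))) *
          Real.exp ((96 * (β / 2) + β) * (Real.sqrt ((Fintype.card (Edge 3 L) : ℝ)) * (8 * (9 * (L : ℝ) * (5 * (powScale (1 / 2) β * btLog β ^ 2)) + powScale 1 β))) ^ 2)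
        = (1 + KD * ((4 + 48 * Ksp) * (8 * (9 * (L : ℝ) * (5 * (powScale (1 / 2) β * btLog β ^ 2)) + powScale 1 β))) ^ 2) *
          (4 : ℝ) ^ (flatDim L / 2 : ℝ) * Real.exp (-(c ^ 2 * (powScale 1 β * btLog β ^ 3) ^ 2 / (4 * powScale 1 β ^ 2)) +
            (96 * (β / 2) + β) * (Real.sqrt ((Fintype.card (Edge 3 L) : ℝ)) * (8 * (9 * (L : ℝ) * (5 * (powScale (1 / 2) β * btLog β ^ 2)) + powScale 1 β))) ^ 2) := by
          rw [Real.exp_add]; ring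
      _ ≤ (1 + |KD| * ((4 + 48 * Ksp) * (8 * (9 * (L : ℝ) * (5 * (powScale (1 / 2) β * btLog β ^ 2)) + powScale 1 β))) ^ 2) *
          (4 : ℝ) ^ (flatDim L / 2 : ℝ) * Real.exp (-btLog β) := by
          gcongr

/-- ★ The slice Laplace tail alone: `(1 + K_D((4+48K_sp)ρ)²)·4^{d/2}·e^{-c_L²ℓ⁶/4} → 0`. [folklore] -/
theorem tendsto_sliceTail [NeZero L] (KD Ksp : ℝ) :
    Tendsto (fun β : ℝ => (1 + KD * ((4 + 48 * Ksp) * (8 * (9 * (L : ℝ) * (5 * (powScale (1 / 2) β * btLog β ^ 2)) + powScale 1 β))) ^ 2) *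
        (4 : ℝ) ^ (flatDim L / 2 : ℝ) * Real.exp (-((1 / (4 * sliceConst L)) ^ 2 * (powScale 1 β * btLog β ^ 3) ^ 2 / (4 * (powScale 1 β) ^ 2))))
      atTop (𝓝 0) := by
  have hρ' : Tendsto (fun β : ℝ => KD * ((4 + 48 * Ksp) * (8 * (9 * (L : ℝ) * (5 * (powScale (1 / 2) β * btLog β ^ 2)) + powScale 1 β))) ^ 2) atTop (𝓝 0) := by
    simpa using (((tendsto_schedRho (L := L)).const_mul (4 + 48 * Ksp)).pow 2).const_mul KD
  have hlow : ∀ᶠ β : ℝ in atTop, -(1 / 2 : ℝ) ≤ KD * ((4 + 48 * Ksp) * (8 * (9 * (L : ℝ) * (5 * (powScale (1 / 2) β * btLog β ^ 2)) + powScale 1 β))) ^ 2 :=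
    hρ'.eventually (Ici_mem_nhds (by norm_num))
  refine tendsto_of_tendsto_of_tendsto_of_le_of_le' tendsto_const_nhds (tendsto_sliceTail_mul_gaussLoss (L := L) KD Ksp) ?_ ?_
  · filter_upwards [hlow] with β hlo
    have : 0 ≤ 1 + KD * ((4 + 48 * Ksp) * (8 * (9 * (L : ℝ) * (5 * (powScale (1 / 2) β * btLog β ^ 2)) + powScale 1 β))) ^ 2 := by linarith
    positivity
  · filter_upwards [hlow, eventually_ge_atTop (1 : ℝ)] with β hlo hβ
    have hP0 : 0 ≤ 1 + KD * ((4 + 48 * Ksp) * (8 * (9 * (L : ℝ) * (5 * (powScale (1 / 2) β * btLog β ^ 2)) + powScale 1 β))) ^ 2 := by linarith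
    have h1 : 1 ≤ Real.exp ((96 * (β / 2) + β) * (Real.sqrt ((Fintype.card (Edge 3 L) : ℝ)) * (8 * (9 * (L : ℝ) * (5 * (powScale (1 / 2) β * btLog β ^ 2)) + powScale 1 β))) ^ 2) := by
      apply Real.one_le_exp
      have : 0 ≤ β := by linarith
      positivity
    have h0 : 0 ≤ (1 + KD * ((4 + 48 * Ksp) * (8 * (9 * (L : ℝ) * (5 * (powScale (1 / 2) β * btLog β ^ 2)) + powScale 1 β))) ^ 2) *
        (4 : ℝ) ^ (flatDim L / 2 : ℝ) * Real.exp (-((1 / (4 * sliceConst L)) ^ 2 * (powScale 1 β * btLog β ^ 3) ^ 2 / (4 * (powScale 1 β) ^ 2))) := by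
      positivity
    exact le_mul_of_one_le_right h0 h1

/-! ## §4 ★ The relative Gaussian tail of the lower bound -/

/-- The Gaussian normalisation against the model integral: `(π/(β/2))^{d/2}/stiffGaussTop ≤ 14^{d}` (`d = 3|E|`). [folklore] -/
theorem gauss_norm_div_stiffGaussTop_le [NeZero L] {β : ℝ} (hβ : 0 < β) :
    (π / (β / 2)) ^ ((Module.finrank ℝ (LinkSpace L) : ℝ) / 2) / stiffGaussTop L (β / 2) β ≤ (14 : ℝ) ^ Fintype.card (Edge 3 L × Fin 3) := by
  have hn : Module.finrank ℝ (LinkSpace L) = Fintype.card (Edge 3 L × Fin 3) := finrank_euclideanSpace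
  obtain ⟨hSlo, -⟩ := stiffGaussTop_record_bounds (L := L) hβ
  have hq0 : 0 < Real.sqrt (π / (98 * β)) := Real.sqrt_pos.2 (by positivity)
  have hS0 : 0 < Real.sqrt (π / (98 * β)) ^ Fintype.card (Edge 3 L × Fin 3) := pow_pos hq0 _
  have hS : 0 < stiffGaussTop L (β / 2) β := lt_of_lt_of_le hS0 hSlo
  have hx0 : 0 ≤ π / (β / 2) := by positivity
  have e1 : (π / (β / 2)) ^ ((Module.finrank ℝ (LinkSpace L) : ℝ) / 2) = Real.sqrt (π / (β / 2)) ^ Fintype.card (Edge 3 L × Fin 3) := by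
    rw [hn, Real.sqrt_eq_rpow, ← Real.rpow_natCast, ← Real.rpow_mul hx0]
    congr 1; ring
  have e2 : Real.sqrt (π / (β / 2)) / Real.sqrt (π / (98 * β)) = 14 := by
    rw [← Real.sqrt_div hx0]
    have : π / (β / 2) / (π / (98 * β)) = 14 ^ 2 := by
      field_simp
      ring
    rw [this, Real.sqrt_sq (by norm_num)]
  rw [e1, div_le_iff₀ hS]
  calc Real.sqrt (π / (β / 2)) ^ Fintype.card (Edge 3 L × Fin 3)
      = (Real.sqrt (π / (β / 2)) / Real.sqrt (π / (98 * β))) ^ Fintype.card (Edge 3 L × Fin 3) * Real.sqrt (π / (98 * β)) ^ Fintype.card (Edge 3 L × Fin 3) := by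
        rw [div_pow, div_mul_cancel₀ _ hS0.ne']
    _ ≤ (14 : ℝ) ^ Fintype.card (Edge 3 L × Fin 3) * stiffGaussTop L (β / 2) β := by
        rw [e2]; gcongr

/-- ★ **The relative Gaussian tail of the lower bound vanishes**: with `m = min(ρ - 2T, R₀ - 6T²R_in) ≥ (89/100)r_f` and
`49βR_in² = (49/144)βr_f²`, the term `e^{49βR_in²}e^{-βm²/2}(2π/β)^{d/2}/stiffGaussTop ≤ 14^{d}e^{-ℓ²/18} → 0`. [folklore] -/
theorem tendsto_gaussTail [NeZero L] :
    Tendsto (fun β : ℝ => Real.exp (49 * β * (min (1 / 40) (powScale (1 / 2) β * btLog β) / 12) ^ 2) *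
      (Real.exp (-(β * (min (8 * (9 * (L : ℝ) * (5 * (powScale (1 / 2) β * btLog β ^ 2)) + powScale 1 β) -
          2 * (9 * (L : ℝ) * (5 * (powScale (1 / 2) β * btLog β ^ 2)) + powScale 1 β))
          (9 / 10 * min (1 / 40) (powScale (1 / 2) β * btLog β) -
            6 * (9 * (L : ℝ) * (5 * (powScale (1 / 2) β * btLog β ^ 2)) + powScale 1 β) ^ 2 * (min (1 / 40) (powScale (1 / 2) β * btLog β) / 12))) ^ 2 / 2)) *
        (π / (β / 2)) ^ ((Module.finrank ℝ (LinkSpace L) : ℝ) / 2)) / stiffGaussTop L (β / 2) β) atTop (𝓝 0) := by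
  have hup : Tendsto (fun β : ℝ => Real.exp (-(btLog β ^ 2 / 18)) * (14 : ℝ) ^ Fintype.card (Edge 3 L × Fin 3)) atTop (𝓝 0) := by
    have h1 : Tendsto (fun β : ℝ => btLog β ^ 2 / 18) atTop atTop :=
      ((tendsto_pow_atTop two_ne_zero).comp tendsto_btLog_atTop).atTop_div_const (by norm_num)
    simpa using (Real.tendsto_exp_atBot.comp (tendsto_neg_atTop_atBot.comp h1)).mul_const ((14 : ℝ) ^ Fintype.card (Edge 3 L × Fin 3))
  have hrf : ∀ᶠ β : ℝ in atTop, powScale (1 / 2) β * btLog β < 1 / 40 := tendsto_rf.eventually (Iio_mem_nhds (by norm_num))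
  have hT : ∀ᶠ β : ℝ in atTop, 9 * (L : ℝ) * (5 * (powScale (1 / 2) β * btLog β ^ 2)) + powScale 1 β < 1 / 8 :=
    (tendsto_schedT (L := L)).eventually (Iio_mem_nhds (by norm_num))
  refine tendsto_of_tendsto_of_tendsto_of_le_of_le' tendsto_const_nhds hup ?_ ?_
  · filter_upwards [eventually_gt_atTop (0 : ℝ)] with β hβ
    obtain ⟨hSlo, -⟩ := stiffGaussTop_record_bounds (L := L) hβ
    have hS : 0 < stiffGaussTop L (β / 2) β := lt_of_lt_of_le (pow_pos (Real.sqrt_pos.2 (by positivity)) _) hSlo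
    positivity
  · filter_upwards [eventually_ge_atTop (1 : ℝ), hrf, hT] with β hβ hrf' hT'
    have hβ0 : 0 < β := by linarith
    have hx := (powScale_pos (1 / 2) β).le
    have hℓ := one_le_btLog β
    have hmin : min (1 / 40) (powScale (1 / 2) β * btLog β) = powScale (1 / 2) β * btLog β := min_eq_right hrf'.le
    have h2 : β * powScale (1 / 2) β ^ 2 = 1 := mul_powScale_half_sq hβ
    rw [hmin]
    set rf := powScale (1 / 2) β * btLog β with hrfdef
    set T := 9 * (L : ℝ) * (5 * (powScale (1 / 2) β * btLog β ^ 2)) + powScale 1 β with hTdef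
    have hrf0 : 0 ≤ rf := by positivity
    have hT0 : 0 ≤ T := by rw [hTdef]; have := powScale_pos 1 β; positivity
    have hrfT : rf ≤ T := by
      have := rf_le_schedT (L := L) β
      rw [hmin] at this
      exact this
    have hT2 : T ^ 2 ≤ 1 / 50 := by nlinarith
    have hβrf : β * rf ^ 2 = btLog β ^ 2 := by
      rw [hrfdef]
      calc β * (powScale (1 / 2) β * btLog β) ^ 2 = (β * powScale (1 / 2) β ^ 2) * btLog β ^ 2 := by ring
        _ = btLog β ^ 2 := by rw [h2, one_mul]
    -- the minimum `m ≥ (89/100) r_f`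
    have hm : 89 / 100 * rf ≤ min (8 * T - 2 * T) (9 / 10 * rf - 6 * T ^ 2 * (rf / 12)) := by
      refine le_min ?_ ?_
      · nlinarith
      · nlinarith
    have hm0 : 0 ≤ min (8 * T - 2 * T) (9 / 10 * rf - 6 * T ^ 2 * (rf / 12)) := le_trans (by positivity) hm
    have hm2 : (89 / 100 * rf) ^ 2 ≤ (min (8 * T - 2 * T) (9 / 10 * rf - 6 * T ^ 2 * (rf / 12))) ^ 2 := pow_le_pow_left₀ (by positivity) hm 2
    have hexp : 49 * β * (rf / 12) ^ 2 + -(β * (min (8 * T - 2 * T) (9 / 10 * rf - 6 * T ^ 2 * (rf / 12))) ^ 2 / 2) ≤ -(btLog β ^ 2 / 18) := by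
      have h1 : β * (89 / 100 * rf) ^ 2 ≤ β * (min (8 * T - 2 * T) (9 / 10 * rf - 6 * T ^ 2 * (rf / 12))) ^ 2 :=
        mul_le_mul_of_nonneg_left hm2 hβ0.le
      have e : 49 * β * (rf / 12) ^ 2 - β * (89 / 100 * rf) ^ 2 / 2 = (49 / 144 - 7921 / 20000) * (β * rf ^ 2) := by ring
      have h3 : (49 / 144 - 7921 / 20000) * (β * rf ^ 2) ≤ -(btLog β ^ 2 / 18) := by
        rw [hβrf]
        have : 0 ≤ btLog β ^ 2 := by positivity
        nlinarith
      linarith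
    have hG := gauss_norm_div_stiffGaussTop_le (L := L) hβ0
    obtain ⟨hSlo, -⟩ := stiffGaussTop_record_bounds (L := L) hβ0
    have hS : 0 < stiffGaussTop L (β / 2) β := lt_of_lt_of_le (pow_pos (Real.sqrt_pos.2 (by positivity)) _) hSlo
    have hG0 : 0 ≤ (π / (β / 2)) ^ ((Module.finrank ℝ (LinkSpace L) : ℝ) / 2) / stiffGaussTop L (β / 2) β := by positivity
    calc Real.exp (49 * β * (rf / 12) ^ 2) *
          (Real.exp (-(β * (min (8 * T - 2 * T) (9 / 10 * rf - 6 * T ^ 2 * (rf / 12))) ^ 2 / 2)) *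
            (π / (β / 2)) ^ ((Module.finrank ℝ (LinkSpace L) : ℝ) / 2)) / stiffGaussTop L (β / 2) β
        = Real.exp (49 * β * (rf / 12) ^ 2 + -(β * (min (8 * T - 2 * T) (9 / 10 * rf - 6 * T ^ 2 * (rf / 12))) ^ 2 / 2)) *
            ((π / (β / 2)) ^ ((Module.finrank ℝ (LinkSpace L) : ℝ) / 2) / stiffGaussTop L (β / 2) β) := by
          rw [Real.exp_add]; ring
      _ ≤ Real.exp (-(btLog β ^ 2 / 18)) * (14 : ℝ) ^ Fintype.card (Edge 3 L × Fin 3) := by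
          gcongr

end Summit.QuantumFields.YangMills.Theorems.FemtoTransferGap.TwoLattice.ConstTube
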